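import Mathlib.Analysis.Asymptotics.AsymptoticEquivalent
import Mathlib.Analysis.SpecialFunctions.Log.Basic
import Literature.Barriers.RiemannHypothesis.MollifierLimitations
import Literature.NumberTheory.LFunctions.ZetaZeros
import HarnessLib
import HarnessLib.Audit

/-!
# Bettin–Conrey–Farmer 2013: the Levinson–Conrey polynomial is optimal in the Nyman–Beurling criterion

NAMED FACT (statement only, D-0014) from S. Bettin, J. B. Conrey, D. W. Farmer, *An optimal choice of
Dirichlet polynomials for the Nyman–Beurling criterion*, Proc. Steklov Inst. Math. 280 (2013),
suppl. 2, S30–S36 = arXiv:1211.5191 [BettinConreyFarmer2013], Theorem 1 (read: §1 pp. 1–3, §3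
Lemmas 2–3 and the proof of Theorem 1, pp. 4–5 of the arXiv version).

## Context

In Báez-Duarte's form of the Nyman–Beurling criterion, RH holds iff `d_N → 0`, where
`d_N² = inf_{A_N} (1/2π) ∫_ℝ |1 - ζA_N(1/2+it)|² dt/(1/4+t²)` over Dirichlet polynomials
`A_N(s) = Σ_{n≤N} a_n n^{-s}` [BettinConreyFarmer2013, §1, first display]. Unconditionally
`liminf d_N² log N ≥ Σ_ρ m(ρ)²/|ρ|²` (Burnol; `Literature.Barriers.RiemannHypothesis.Burnol2002_thm1_3`),
and `d_N² ~ (Σ_ρ m(ρ)²/|ρ|²)/log N` is expected; under RH `Σ_ρ m(ρ)/|ρ|² = 2 + γ - log 4π`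
[BettinConreyFarmer2013, §1]. Theorem 1 of the paper attains this constant, conditionally, with the
explicit polynomial

  `V_N(s) = Σ_{n=1}^{N} (1 - log n/log N) μ(n) n^{-s}`,

which is the Levinson–Conrey mollifier `M_N` of the barrier catalogue
(`Literature.Barriers.RiemannHypothesis.levinsonMollifier`, [BettinGonek2017, §1]); we use that
definition rather than introduce a synonym.

## What is vendored

* `bcfDistSq N` — the paper's quantity `(1/2π) ∫_ℝ |1 - ζV_N(1/2+it)|² dt/(1/4+t²)` (a real Bochner
  integral; the integrand is continuous and `O((1+|t|)^{-3/2+2ε})` by the convexity bound for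
  `ζ(1/2+it)`, hence integrable, so no junk value arises; for `N = 0`, `V_0 = 0` and the value is
  `1`; for `N = 1`, `V_1 = 1` since Lean's `log 1/log 1 = 0/0 = 0`).
* `BettinConreyFarmer2013_hyp` — the paper's condition (2),
  "`Σ_{|Im ρ| ≤ T} |ζ'(ρ)|⁻² ≪ T^{3/2-δ}` for some `δ > 0`", together with the simplicity of all
  non-trivial zeros, which the paper says (2) "implicitly assumes" (p. 3) and which we must state
  explicitly because Lean's `1/0 = 0` would otherwise let a multiple zero contribute `0` instead
  of `∞`. The sum is written over the finite box `zetaZeroBox 0 T` (`0 < Im ρ ≤ T`, each zero once,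
  `Literature.NumberTheory.LFunctions.zetaZeroBox_finite`); the zeros with `-T ≤ Im ρ < 0` are the
  conjugates, with the same `|ζ'(ρ)|` (`ζ(conj s) = conj ζ(s)`), so the printed two-sided sum is
  exactly twice ours and the `≪` is unaffected. "`≪`" is read as one constant for all `T ≥ 2`
  (equivalent to "all large `T`": the left side is non-decreasing in `T` and finite;
  `BettinConreyFarmer2013_hyp_iff_eventually` in `BettinConreyFarmer2013Hypothesis.lean`). This is an
  OPEN hypothesis, not a theorem (docstring `[status: open]`, registered open statement
  `@[conjecture]` like `SimpleZerosConjecture` in `RHWave0.lean`): its first conjunct is the Simple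
  Zeros Conjecture and no upper bound at all is known for the second; it is only ever assumed.
* `BettinConreyFarmer2013_thm1` — **Theorem 1**: RH and (2) imply
  `bcfDistSq N ~ (2 + γ - log 4π)/log N` (`Asymptotics.IsEquivalent` along `N → ∞` in `ℕ`; the
  right side is `> 0` for `N ≥ 2` since `2 + γ - log 4π = 0.0461…`, and its junk value `c/0 = 0` at
  `N = 0, 1` is invisible to `~[atTop]`).
* Proved glue: `bcfDistSq_nonneg`, `BettinConreyFarmer2013_thm1.tendsto_zero` and `.isBigO`
  (under the fact, RH and (2) give `bcfDistSq N → 0` at the rate `O(1/log N)`, i.e. the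
  Möbius–Levinson polynomials realise the Nyman–Beurling criterion).

## What is NOT here (and where it is)

No proof in THIS file. Theorem 1 is PROVED in the companion chain
`BettinConreyFarmer2013Zeros → …ZeroSums → …LocalFactor / …ExplicitFormula → …ZeroSumAnalytic →
…Psi → BettinConreyFarmer2013Proofs.lean`, ending in
`Literature.NumberTheory.LFunctions.BettinConreyFarmer2013_thm1_holds : BettinConreyFarmer2013_thm1`
(the printed argument of §3: Lemma 2, the explicit formula for `V_N`; the line of integration moved
to `Re s = 1/2 + ε`; the sum `Σ_ρ N^{ρ-s}/(ζ'(ρ)(ρ-s)²)` controlled by (2); the constant via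
`Σ_ρ 1/(ρ(1-ρ)) = 2 + γ - log 4π`). The logical status of hypothesis (2) — conjunct (i) `↔`
`SimpleZerosConjecture`, the "`≪` for `T ≥ 2`" reading — is kernel-checked in
`BettinConreyFarmer2013Hypothesis.lean`. Theorem 2 (the polynomial analogue) is not vendored. The
link to the route `Summits/RiemannHypothesis/…/Theses/NymanBeurling.lean` (cruxes `NbRateLog`,
`NbMoebiusMollifier`, whose polynomial is `levinsonMollifier` re-indexed over `Fin N`) is proved on
the summit side (`Theorems/NymanBeurlingNbMoebiusLevinson.lean`), not here.

## Mathlib / tree objects used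

`riemannZeta`, `RiemannHypothesis`, `Real.eulerMascheroniConstant`, `Asymptotics.IsEquivalent`;
`Literature.Barriers.RiemannHypothesis.levinsonMollifier` (the polynomial `V_N = M_N`),
`Literature.NumberTheory.LFunctions.zetaZeroBox` (finite boxes of zeros).
-/

noncomputable section

open Complex Filter Asymptotics MeasureTheory
open scoped Real Topology

namespace Literature.NumberTheory.LFunctions

open Literature.Barriers.RiemannHypothesis (levinsonMollifier)

/-! ### The objects -/

/-- Bettin–Conrey–Farmer's normalised squared distance for the Levinson–Conrey polynomial
`V_N = levinsonMollifier N`: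
`bcfDistSq N = (1/2π) ∫_ℝ ‖1 - ζ(1/2+it) V_N(1/2+it)‖² dt/(1/4+t²)` (so that `d_N² ≤ bcfDistSq N`,
`d_N` Báez-Duarte's distance). A real Bochner integral of a non-negative integrable function.
[cite: BettinConreyFarmer2013, Thm. 1 (left-hand side)] -/
def bcfDistSq (N : ℕ) : ℝ :=
  1 / (2 * π) * ∫ t : ℝ, ‖1 - riemannZeta (1 / 2 + t * I) *
    levinsonMollifier N (1 / 2 + t * I)‖ ^ 2 / (1 / 4 + t ^ 2)

/-- `bcfDistSq N ≥ 0`. [folklore] -/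
theorem bcfDistSq_nonneg (N : ℕ) : 0 ≤ bcfDistSq N :=
  mul_nonneg (by positivity) (integral_nonneg fun t ↦ by positivity)

/-- OPEN CONJECTURE — **Bettin–Conrey–Farmer's condition (2), with the simplicity it presupposes**,
the HYPOTHESIS of [BettinConreyFarmer2013, Thm. 1] (posed there as an assumption, p. 3; a weak form
of the Gonek–Hejhal conjecture, Gonek 1989 [Gonek1989] / Hejhal 1989, refined by
Hughes–Keating–O'Connell 2000 [HughesKeatingOConnell2000]) [status: open]: "(2):
`Σ_{|Im ρ| ≤ T} 1/|ζ'(ρ)|² ≪ T^{3/2-δ}` for some `δ > 0`"; "The condition (2) implicitly assumes that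
the zeros of the Riemann zeta function are all simple" (p. 3). Stated as: every non-trivial zero is
simple (`ζ'(ρ) ≠ 0`), and for some `δ > 0` and `C`, for all `T ≥ 2`,
`Σ_{ρ ∈ zetaZeroBox 0 T} 1/‖ζ'(ρ)‖² ≤ C T^{3/2-δ}` (zeros with `0 < Im ρ ≤ T`, each once; the
printed two-sided sum is twice this by conjugation symmetry). The paper calls (2) "mild": Gonek's
conjecture, supported by Hughes–Keating–O'Connell, predicts `Σ_{|Im ρ|≤T} |ζ'(ρ)|⁻² ~ (6/π³) T`.

Status: open — nothing here can be discharged or refuted with present knowledge; this `def` is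
hypothesis vocabulary (like `RiemannHypothesis`), used only as the antecedent of
`BettinConreyFarmer2013_thm1` (itself PROVED: `BettinConreyFarmer2013_thm1_holds` in
`BettinConreyFarmer2013Proofs.lean`). Conjunct (i) is *verbatim* the Simple Zeros Conjecture
(`BettinConreyFarmer2013_hyp_simple_iff`, `BettinConreyFarmer2013_hyp.simpleZerosConjecture` in
`BettinConreyFarmer2013Hypothesis.lean`; `SimpleZerosConjecture`, in `RHWave0.lean`, is itself open).
Conjunct (ii) is open even under RH and (i): "No upper bounds are known for `J_{-k}(T)` in the case
when `k > 0`" and, over all zeros, "simply assuming RH and the simplicity of zeros is not enough"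
[BuiFloreaMilinovich2023, §1.1–1.2] (even the Weak Mertens Conjecture gives only `J_{-1} = o(T²)`
on dyadic ranges, ibid. §1.2); only lower bounds are known (`J_{-1}(T) ≫ T` under RH and (i),
[Gonek1989]). There is therefore no `BettinConreyFarmer2013_hyp_holds`, and none is literature debt.
Verdict of the tenured provefact seat (open problem; statement faithful, not misstated), re-verified
2026-08-15 against arXiv:1211.5191 p. 3 and [BuiFloreaMilinovich2023, §1.1–1.2]: registered as an
open statement (`@[conjecture]`: an obligation node, provable or refutable by name, never a vendored
fact), exactly as `SimpleZerosConjecture`, which conjunct (i) restates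
(`BettinConreyFarmer2013_hyp.simpleZerosConjecture`); name and statement unchanged (users:
`BettinConreyFarmer2013_thm1` below, `BettinConreyFarmer2013Hypothesis.lean`,
`BettinConreyFarmer2013Proofs.lean`).
[cite: BettinConreyFarmer2013, Thm. 1, condition (2) and p. 3] -/
@[conjecture] def BettinConreyFarmer2013_hyp : Prop :=
  (∀ ρ : ℂ, riemannZeta ρ = 0 → 0 < ρ.re → ρ.re < 1 → deriv riemannZeta ρ ≠ 0) ∧
    ∃ δ : ℝ, 0 < δ ∧ ∃ C : ℝ, ∀ T : ℝ, 2 ≤ T →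
      ∑ᶠ ρ ∈ zetaZeroBox 0 T, 1 / ‖deriv riemannZeta ρ‖ ^ 2 ≤ C * T ^ (3 / 2 - δ)

/-- **NAMED FACT — Bettin–Conrey–Farmer 2013, Theorem 1.** "If the Riemann hypothesis is true and
if `Σ_{|Im ρ| ≤ T} 1/|ζ'(ρ)|² ≪ T^{3/2-δ}` for some `δ > 0`, then
`(1/2π) ∫_{-∞}^{∞} |1 - ζV_N(1/2+it)|² dt/(1/4+t²) ~ (2 + γ - log 4π)/log N`", with
`V_N(s) = Σ_{n=1}^{N} (1 - log n/log N) μ(n) n^{-s}` (`= levinsonMollifier N s`). Here `γ` is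
Euler's constant and `2 + γ - log 4π = Σ_ρ 1/|ρ|²` under RH, Burnol's lower-bound constant, so
`V_N` is asymptotically optimal. Users take `(h : BettinConreyFarmer2013_thm1)`.
[cite: BettinConreyFarmer2013, Thm. 1] -/
def BettinConreyFarmer2013_thm1 : Prop :=
  RiemannHypothesis → BettinConreyFarmer2013_hyp →
    bcfDistSq ~[atTop] fun N : ℕ ↦
      (2 + Real.eulerMascheroniConstant - Real.log (4 * π)) / Real.log (N : ℝ)

/-! ### Proved consequences -/

/-- Under the fact, RH and condition (2) give the rate `bcfDistSq N = O(1/log N)`.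
[cite: BettinConreyFarmer2013, Thm. 1] -/
theorem BettinConreyFarmer2013_thm1.isBigO (h : BettinConreyFarmer2013_thm1)
    (hRH : RiemannHypothesis) (h2 : BettinConreyFarmer2013_hyp) :
    bcfDistSq =O[atTop] fun N : ℕ ↦ (Real.log (N : ℝ))⁻¹ := by
  refine (h hRH h2).isBigO.trans ?_
  simpa only [div_eq_mul_inv] using
    isBigO_const_mul_self (2 + Real.eulerMascheroniConstant - Real.log (4 * π))
      (fun N : ℕ ↦ (Real.log (N : ℝ))⁻¹) atTop

/-- Under the fact, RH and condition (2) give `bcfDistSq N → 0`: the Levinson–Conrey (smoothed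
Möbius) polynomials realise the Nyman–Beurling–Báez-Duarte criterion. [cite: BettinConreyFarmer2013, Thm. 1] -/
theorem BettinConreyFarmer2013_thm1.tendsto_zero (h : BettinConreyFarmer2013_thm1)
    (hRH : RiemannHypothesis) (h2 : BettinConreyFarmer2013_hyp) :
    Tendsto bcfDistSq atTop (𝓝 0) :=
  (h.isBigO hRH h2).trans_tendsto
    ((Real.tendsto_log_atTop.comp tendsto_natCast_atTop_atTop).inv_tendsto_atTop)

end Literature.NumberTheory.LFunctions

end
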